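import Literature.Probability.RandomPlanarGeometry.SLERestrictionSmooth
import Literature.Probability.RandomPlanarGeometry.ArcApproximation
import Literature.Probability.RandomPlanarGeometry.KernelConvergence
import Mathlib.Analysis.Complex.LocallyUniformLimit
import Mathlib.Analysis.SpecialFunctions.Trigonometric.Deriv
import HarnessLib

/-!
# [LSW] Lemma 2.1 for smooth hulls, proved: the hulls `E_δ` have regular `C¹` boundary arcs

G. F. Lawler, O. Schramm, W. Werner, *Conformal restriction: the chordal case*, J. Amer. Math.
Soc. **16** (2003) 917–955, arXiv:math/0209343 (**[LSW]**), Lemma 2.1 (p. 8) and the hulls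
`E_δ = cl(A ∪ Φ_A⁻¹(D_δ))` of the proof of Lemma 3.5 (p. 13).

`ArcApproximation` carries out [LSW]'s construction and proves that the `E_δ` are `*`-hulls
bounded in `ℍ` by a Jordan arc (`IsArcHull`), decreasing to `A ∪ [p, q]`, with
`Φ_{E_δ} → Φ_A` uniformly on compacta. This file adds what the named fact
`Literature.Probability.RandomPlanarGeometry.IsPlusHull.exists_antitone_isSmoothHull` (`SLERestrictionSmooth`; [LSW] Lemma 2.1 for
SMOOTH hulls with the convergence of the derivatives at `0`) asks for, and DISCHARGES it:

* the boundary arc of the stadium `D_δ([a, b])` has a regular `C¹` parametrisation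
  (`smoothStadiumArc`: quarter circle, segment, quarter circle, by arc length — the graph
  parametrisation `stadiumArc` of `ArcApproximation` has vertical tangents at the endpoints),
  with the same trace as `stadiumArc`;
* hence `ℍ ∩ ∂E_δ = Φ_A⁻¹(ℍ ∩ ∂D_δ)` is a regular `C¹` arc (`E⁻¹` is conformal near the closed
  arc, `HasDerivAt.of_local_left_inverse`), and `E_δ` is a smooth hull (`isSmoothHull_arcHull`);
* `E_δ ∈ 𝒬₊` when `A` lies over the positive axis (`isPlusHull_arcHull`);
* `Φ'_{E_δₙ}(0) ↑ Φ'_A(0)`: monotone by `HasRestrictionDeriv.le_of_subset`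
  (`HullSubordination`), convergent by Cauchy's formula for the Schwarz-reflected extensions
  (`reflectExt`, `KernelConvergence`), which converge uniformly on a disc around `0` since the
  maps do on its upper half (`tendstoUniformlyOn_arcHull`) — [LSW] p. 12: "It is immediate that
  `Φ'_{A_n}(0) → Φ'_A(0)`, by Cauchy's derivative formula (the maps may be extended to a
  neighborhood of `0` by Schwarz reflection in the real line)";
* `Literature.Probability.RandomPlanarGeometry.IsPlusHull.exists_antitone_isSmoothHull_holds`.
-/

noncomputable section

open Set Filter Topology Metric Bornology Complex
open UpperHalfPlane (upperHalfPlaneSet isOpen_upperHalfPlaneSet)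
open scoped ComplexConjugate

namespace Literature.Probability.RandomPlanarGeometry

/-! ### Gluing `C¹` functions -/

/-- Gluing two everywhere-differentiable functions `ℝ → ℂ` at a point where their values and
derivatives agree gives an everywhere-differentiable function. [folklore] -/
theorem hasDerivAt_ite_le {f g f' g' : ℝ → ℂ} {c : ℝ} (hf : ∀ x, HasDerivAt f (f' x) x)
    (hg : ∀ x, HasDerivAt g (g' x) x) (hfg : f c = g c) (hfg' : f' c = g' c) (x : ℝ) :
    HasDerivAt (fun y ↦ if y ≤ c then f y else g y) (if x ≤ c then f' x else g' x) x := by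
  rcases lt_trichotomy x c with hx | rfl | hx
  · rw [if_pos hx.le]
    refine (hf x).congr_of_eventuallyEq ?_
    filter_upwards [Iio_mem_nhds hx] with y hy
    rw [if_pos (le_of_lt hy)]
  · rw [if_pos le_rfl]
    have h1 : HasDerivWithinAt (fun y ↦ if y ≤ x then f y else g y) (f' x) (Iic x) x :=
      (hf x).hasDerivWithinAt.congr (fun y hy ↦ by rw [if_pos (mem_Iic.1 hy)]) (by rw [if_pos le_rfl])
    have h2 : HasDerivWithinAt (fun y ↦ if y ≤ x then f y else g y) (f' x) (Ici x) x := by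
      rw [hfg']
      refine (hg x).hasDerivWithinAt.congr (fun y hy ↦ ?_) (by rw [if_pos le_rfl, hfg])
      rcases (mem_Ici.1 hy).lt_or_eq with h | h
      · rw [if_neg (not_le.2 h)]
      · rw [← h, if_pos le_rfl, hfg]
    have := h1.union h2
    rwa [Iic_union_Ici, hasDerivWithinAt_univ] at this
  · rw [if_neg (not_le.2 hx)]
    refine (hg x).congr_of_eventuallyEq ?_
    filter_upwards [Ioi_mem_nhds hx] with y hy
    rw [if_neg (not_le.2 hy)]

/-! ### A regular `C¹` parametrisation of the boundary arc of the stadium -/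

section SmoothStadium

variable {a b δ : ℝ}

/-- The three pieces of the arc-length parametrisation of the stadium boundary: the left
quarter circle `a − δ e^{−is}`, the top segment `a + δ(s − π/2) + iδ`, the right quarter circle
`b + iδ e^{−i(s − s₁)}`, `s₁ = π/2 + (b − a)/δ`. [folklore] -/
def stadiumPiece₁ (a δ s : ℝ) : ℂ := a - δ * exp (-I * s)

/-- The junction parameter `s₁ = π/2 + (b − a)/δ` between the segment and the right cap. [folklore] -/
def stadiumS₁ (a b δ : ℝ) : ℝ := Real.pi / 2 + (b - a) / δ

/-- The top segment of the stadium boundary. [folklore] -/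
def stadiumPiece₂ (a δ s : ℝ) : ℂ := a + δ * (s - Real.pi / 2) + δ * I

/-- The right quarter circle of the stadium boundary. [folklore] -/
def stadiumPiece₃ (a b δ s : ℝ) : ℂ := b + δ * I * exp (-I * (s - stadiumS₁ a b δ))

/-- The total parameter length `π + (b − a)/δ`. [folklore] -/
def stadiumLen (a b δ : ℝ) : ℝ := Real.pi + (b - a) / δ

/-- **Arc-length parametrisation of the stadium boundary** on `[0, π + (b−a)/δ]`. [folklore] -/
def stadiumPath (a b δ s : ℝ) : ℂ :=
  if s ≤ Real.pi / 2 then stadiumPiece₁ a δ s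
  else if s ≤ stadiumS₁ a b δ then stadiumPiece₂ a δ s else stadiumPiece₃ a b δ s

/-- The velocity of `stadiumPath`. [folklore] -/
def stadiumPathDeriv (a b δ s : ℝ) : ℂ :=
  if s ≤ Real.pi / 2 then δ * I * exp (-I * s)
  else if s ≤ stadiumS₁ a b δ then (δ : ℂ) else δ * exp (-I * (s - stadiumS₁ a b δ))

/-- `e^{−is} = cos s − i sin s`. [folklore] -/
theorem exp_neg_I_mul_ofReal (s : ℝ) : exp (-I * s) = Real.cos s - Real.sin s * I := by
  rw [show -I * (s : ℂ) = ((-s : ℝ) : ℂ) * I by push_cast; ring, exp_mul_I, ← ofReal_cos,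
    ← ofReal_sin, Real.cos_neg, Real.sin_neg]
  push_cast
  ring

/-- Velocity of the left cap. [folklore] -/
theorem hasDerivAt_stadiumPiece₁ (a δ s : ℝ) :
    HasDerivAt (stadiumPiece₁ a δ) (δ * I * exp (-I * s)) s := by
  have h1 : HasDerivAt (fun s : ℝ ↦ -I * (s : ℂ)) (-I * 1) s :=
    (hasDerivAt_id s).ofReal_comp.const_mul (-I)
  have h2 := ((h1.cexp).const_mul (δ : ℂ)).const_sub (a : ℂ)
  refine h2.congr_deriv ?_
  ring

/-- Velocity of the top segment. [folklore] -/
theorem hasDerivAt_stadiumPiece₂ (a δ s : ℝ) : HasDerivAt (stadiumPiece₂ a δ) (δ : ℂ) s := by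
  have h1 : HasDerivAt (fun s : ℝ ↦ ((s : ℂ) - Real.pi / 2)) 1 s := by
    simpa using (hasDerivAt_id s).ofReal_comp.sub_const ((Real.pi / 2 : ℝ) : ℂ)
  have h2 := ((h1.const_mul (δ : ℂ)).const_add (a : ℂ)).add_const ((δ : ℂ) * I)
  simp only [mul_one] at h2
  refine h2.congr_of_eventuallyEq (Eventually.of_forall fun x ↦ ?_)
  simp [stadiumPiece₂]

/-- Velocity of the right cap. [folklore] -/
theorem hasDerivAt_stadiumPiece₃ (a b δ s : ℝ) :
    HasDerivAt (stadiumPiece₃ a b δ) (δ * exp (-I * (s - stadiumS₁ a b δ))) s := by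
  have h1 : HasDerivAt (fun s : ℝ ↦ -I * ((s : ℂ) - stadiumS₁ a b δ)) (-I * 1) s :=
    ((hasDerivAt_id s).ofReal_comp.sub_const ((stadiumS₁ a b δ : ℝ) : ℂ)).const_mul (-I)
  have h2 := ((h1.cexp).const_mul ((δ : ℂ) * I)).const_add (b : ℂ)
  refine h2.congr_deriv ?_
  rw [mul_one, show (δ : ℂ) * I * (exp (-I * ((s : ℂ) - stadiumS₁ a b δ)) * -I)
    = -(I * I) * (δ * exp (-I * ((s : ℂ) - stadiumS₁ a b δ))) by ring, I_mul_I]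
  ring

/-- The pieces agree at the first junction `π/2`. [folklore] -/
theorem stadiumPiece₁_pi_div_two (a δ : ℝ) :
    stadiumPiece₁ a δ (Real.pi / 2) = stadiumPiece₂ a δ (Real.pi / 2) := by
  rw [stadiumPiece₁, stadiumPiece₂, exp_neg_I_mul_ofReal, Real.cos_pi_div_two, Real.sin_pi_div_two]
  push_cast
  ring

/-- The velocities agree at the first junction. [folklore] -/
theorem stadiumPathDeriv_junction₁ (δ : ℝ) : (δ : ℂ) * I * exp (-I * ((Real.pi / 2 : ℝ) : ℂ)) = δ := by
  rw [exp_neg_I_mul_ofReal, Real.cos_pi_div_two, Real.sin_pi_div_two]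
  push_cast
  rw [zero_sub, one_mul, mul_assoc, mul_neg, I_mul_I]
  ring

/-- The pieces agree at the second junction `s₁`. [folklore] -/
theorem stadiumPiece₂_stadiumS₁ (hδ : 0 < δ) :
    stadiumPiece₂ a δ (stadiumS₁ a b δ) = stadiumPiece₃ a b δ (stadiumS₁ a b δ) := by
  have hδ0 : (δ : ℂ) ≠ 0 := ofReal_ne_zero.2 hδ.ne'
  rw [stadiumPiece₂, stadiumPiece₃, stadiumS₁]
  push_cast
  rw [sub_self, mul_zero, exp_zero, mul_one]
  field_simp
  ring

/-- **`stadiumPath` is differentiable everywhere, with velocity `stadiumPathDeriv`** (the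
pieces match to first order at the two junctions). [folklore] -/
theorem hasDerivAt_stadiumPath (hab : a ≤ b) (hδ : 0 < δ) (s : ℝ) :
    HasDerivAt (stadiumPath a b δ) (stadiumPathDeriv a b δ s) s := by
  have hS₁ : Real.pi / 2 ≤ stadiumS₁ a b δ := by
    rw [stadiumS₁]
    have : 0 ≤ (b - a) / δ := div_nonneg (by linarith) hδ.le
    linarith
  -- glue the segment and the right cap at `s₁`
  have h23 : ∀ x, HasDerivAt
      (fun y ↦ if y ≤ stadiumS₁ a b δ then stadiumPiece₂ a δ y else stadiumPiece₃ a b δ y)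
      (if x ≤ stadiumS₁ a b δ then (δ : ℂ) else δ * exp (-I * (x - stadiumS₁ a b δ))) x :=
    hasDerivAt_ite_le (f' := fun _ ↦ (δ : ℂ)) (hasDerivAt_stadiumPiece₂ a δ)
      (hasDerivAt_stadiumPiece₃ a b δ) (stadiumPiece₂_stadiumS₁ hδ) (by simp)
  -- glue the left cap at `π/2`
  have h2v : (if Real.pi / 2 ≤ stadiumS₁ a b δ then stadiumPiece₂ a δ (Real.pi / 2)
      else stadiumPiece₃ a b δ (Real.pi / 2)) = stadiumPiece₂ a δ (Real.pi / 2) := if_pos hS₁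
  have h2d : (if Real.pi / 2 ≤ stadiumS₁ a b δ then (δ : ℂ)
      else δ * exp (-I * ((Real.pi / 2 : ℝ) - stadiumS₁ a b δ))) = δ := if_pos hS₁
  exact hasDerivAt_ite_le (hasDerivAt_stadiumPiece₁ a δ) h23
    ((stadiumPiece₁_pi_div_two a δ).trans h2v.symm)
    ((stadiumPathDeriv_junction₁ δ).trans h2d.symm) s

/-- The velocity is continuous. [folklore] -/
theorem continuous_stadiumPathDeriv (hab : a ≤ b) (hδ : 0 < δ) :
    Continuous (stadiumPathDeriv a b δ) := by
  have hS₁ : Real.pi / 2 ≤ stadiumS₁ a b δ := by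
    rw [stadiumS₁]
    have : 0 ≤ (b - a) / δ := div_nonneg (by linarith) hδ.le
    linarith
  have h2d : (if Real.pi / 2 ≤ stadiumS₁ a b δ then (δ : ℂ)
      else δ * exp (-I * ((Real.pi / 2 : ℝ) - stadiumS₁ a b δ))) = δ := if_pos hS₁
  refine Continuous.if_le (by fun_prop) ?_ continuous_id continuous_const fun x hx ↦ ?_
  · exact Continuous.if_le continuous_const (by fun_prop) continuous_id continuous_const
      fun x hx ↦ by rw [hx]; simp
  · rw [hx]
    exact (stadiumPathDeriv_junction₁ δ).trans h2d.symm

/-- The velocity never vanishes (it has norm `δ`). [folklore] -/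
theorem stadiumPathDeriv_ne_zero (hδ : 0 < δ) (s : ℝ) : stadiumPathDeriv a b δ s ≠ 0 := by
  have hδ0 : (δ : ℂ) ≠ 0 := ofReal_ne_zero.2 hδ.ne'
  unfold stadiumPathDeriv
  split_ifs
  · exact mul_ne_zero (mul_ne_zero hδ0 I_ne_zero) (exp_ne_zero _)
  · exact hδ0
  · exact mul_ne_zero hδ0 (exp_ne_zero _)

/-! #### Real and imaginary parts of the pieces -/

/-- Real part of the left cap: `a − δ cos s`. [folklore] -/
theorem stadiumPiece₁_re (a δ s : ℝ) : (stadiumPiece₁ a δ s).re = a - δ * Real.cos s := by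
  rw [stadiumPiece₁, exp_neg_I_mul_ofReal]
  simp [Complex.cos_ofReal_re, Complex.sin_ofReal_re]

/-- Imaginary part of the left cap: `δ sin s`. [folklore] -/
theorem stadiumPiece₁_im (a δ s : ℝ) : (stadiumPiece₁ a δ s).im = δ * Real.sin s := by
  rw [stadiumPiece₁, exp_neg_I_mul_ofReal]
  simp [Complex.cos_ofReal_re, Complex.sin_ofReal_re]

/-- Real part of the top segment. [folklore] -/
theorem stadiumPiece₂_re (a δ s : ℝ) : (stadiumPiece₂ a δ s).re = a + δ * (s - Real.pi / 2) := by
  simp [stadiumPiece₂]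

/-- Imaginary part of the top segment: `δ`. [folklore] -/
theorem stadiumPiece₂_im (a δ s : ℝ) : (stadiumPiece₂ a δ s).im = δ := by
  simp [stadiumPiece₂]

/-- Real and imaginary parts of `b + δ i e^{−iu}`. [folklore] -/
theorem re_im_rightCap (b δ u : ℝ) :
    ((b : ℂ) + δ * I * exp (-I * u)).re = b + δ * Real.sin u ∧
      ((b : ℂ) + δ * I * exp (-I * u)).im = δ * Real.cos u := by
  rw [exp_neg_I_mul_ofReal]
  constructor <;> simp [Complex.cos_ofReal_re, Complex.sin_ofReal_re]

/-- Real part of the right cap: `b + δ sin(s − s₁)`. [folklore] -/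
theorem stadiumPiece₃_re (a b δ s : ℝ) :
    (stadiumPiece₃ a b δ s).re = b + δ * Real.sin (s - stadiumS₁ a b δ) := by
  rw [stadiumPiece₃, show -I * ((s : ℂ) - stadiumS₁ a b δ) = -I * ((s - stadiumS₁ a b δ : ℝ) : ℂ) by
    push_cast; ring]
  exact (re_im_rightCap b δ _).1

/-- Imaginary part of the right cap: `δ cos(s − s₁)`. [folklore] -/
theorem stadiumPiece₃_im (a b δ s : ℝ) :
    (stadiumPiece₃ a b δ s).im = δ * Real.cos (s - stadiumS₁ a b δ) := by
  rw [stadiumPiece₃, show -I * ((s : ℂ) - stadiumS₁ a b δ) = -I * ((s - stadiumS₁ a b δ : ℝ) : ℂ) by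
    push_cast; ring]
  exact (re_im_rightCap b δ _).2

/-- Real part of `δ e^{−iu}`. [folklore] -/
theorem re_rightCapDeriv (δ u : ℝ) : ((δ : ℂ) * exp (-I * u)).re = δ * Real.cos u := by
  rw [exp_neg_I_mul_ofReal]
  simp [Complex.cos_ofReal_re, Complex.sin_ofReal_re]

/-- Real part of the velocity on the left cap. [folklore] -/
theorem stadiumPathDeriv_re_of_le {s : ℝ} (hs : s ≤ Real.pi / 2) :
    (stadiumPathDeriv a b δ s).re = δ * Real.sin s := by
  rw [stadiumPathDeriv, if_pos hs, exp_neg_I_mul_ofReal]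
  simp [Complex.cos_ofReal_re, Complex.sin_ofReal_re]

/-- Real part of the velocity on the right cap. [folklore] -/
theorem stadiumPathDeriv_re_of_lt {s : ℝ} (hs : stadiumS₁ a b δ < s) (hS₁ : Real.pi / 2 ≤ stadiumS₁ a b δ) :
    (stadiumPathDeriv a b δ s).re = δ * Real.cos (s - stadiumS₁ a b δ) := by
  rw [stadiumPathDeriv, if_neg (not_le.2 (lt_of_le_of_lt hS₁ hs)), if_neg (not_le.2 hs),
    show -I * ((s : ℂ) - stadiumS₁ a b δ) = -I * ((s - stadiumS₁ a b δ : ℝ) : ℂ) by push_cast; ring]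
  exact re_rightCapDeriv δ _

/-! #### The path on `[0, π + (b − a)/δ]` -/

/-- `L = s₁ + π/2`. [folklore] -/
theorem stadiumLen_eq : stadiumLen a b δ = stadiumS₁ a b δ + Real.pi / 2 := by
  rw [stadiumLen, stadiumS₁]; ring


/-- The path starts at `a − δ`. [folklore] -/
theorem stadiumPath_zero : stadiumPath a b δ 0 = ((a - δ : ℝ) : ℂ) := by
  rw [stadiumPath, if_pos (by linarith [Real.pi_pos]), stadiumPiece₁]
  push_cast
  simp

/-- The real part of the path, per piece. [folklore] -/
theorem stadiumPath_re (s : ℝ) : (stadiumPath a b δ s).re =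
    if s ≤ Real.pi / 2 then a - δ * Real.cos s
    else if s ≤ stadiumS₁ a b δ then a + δ * (s - Real.pi / 2)
    else b + δ * Real.sin (s - stadiumS₁ a b δ) := by
  rw [stadiumPath]
  split_ifs
  · exact stadiumPiece₁_re a δ s
  · exact stadiumPiece₂_re a δ s
  · exact stadiumPiece₃_re a b δ s

variable (hab : a ≤ b) (hδ : 0 < δ)
include hab hδ


/-- `π/2 ≤ s₁`. [folklore] -/
theorem pi_div_two_le_stadiumS₁ : Real.pi / 2 ≤ stadiumS₁ a b δ := by
  rw [stadiumS₁]
  have : 0 ≤ (b - a) / δ := div_nonneg (by linarith) hδ.le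
  linarith

omit hab hδ in
/-- `s₁ < L = s₁ + π/2`. [folklore] -/
theorem stadiumS₁_lt_stadiumLen : stadiumS₁ a b δ < stadiumLen a b δ := by
  rw [stadiumLen_eq]; linarith [Real.pi_pos]

/-- `0 < L`. [folklore] -/
theorem stadiumLen_pos : 0 < stadiumLen a b δ :=
  lt_of_lt_of_le (lt_of_lt_of_le (by linarith [Real.pi_pos]) (pi_div_two_le_stadiumS₁ hab hδ))
    (stadiumS₁_lt_stadiumLen (a := a) (b := b) (δ := δ)).le

/-- The path ends at `b + δ`. [folklore] -/
theorem stadiumPath_len : stadiumPath a b δ (stadiumLen a b δ) = ((b + δ : ℝ) : ℂ) := by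
  have h1 := stadiumS₁_lt_stadiumLen (a := a) (b := b) (δ := δ)
  have h2 := pi_div_two_le_stadiumS₁ hab hδ
  rw [stadiumPath, if_neg (not_le.2 (lt_of_le_of_lt h2 h1)), if_neg (not_le.2 h1), stadiumPiece₃,
    show -I * ((stadiumLen a b δ : ℂ) - stadiumS₁ a b δ) = -I * ((Real.pi / 2 : ℝ) : ℂ) by
      rw [stadiumLen_eq]; push_cast; ring, exp_neg_I_mul_ofReal, Real.cos_pi_div_two,
    Real.sin_pi_div_two]
  push_cast
  rw [zero_sub, one_mul, mul_assoc, mul_neg, I_mul_I]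
  ring

/-- **The path lies in `ℍ` at interior times.** [folklore] -/
theorem stadiumPath_im_pos {s : ℝ} (hs : s ∈ Ioo 0 (stadiumLen a b δ)) : 0 < (stadiumPath a b δ s).im := by
  have hS₁ := pi_div_two_le_stadiumS₁ hab hδ
  rw [stadiumPath]
  split_ifs with h1 h2
  · rw [stadiumPiece₁_im]
    exact mul_pos hδ (Real.sin_pos_of_pos_of_lt_pi hs.1 (by linarith [Real.pi_pos]))
  · rw [stadiumPiece₂_im]; exact hδ
  · rw [stadiumPiece₃_im]
    refine mul_pos hδ (Real.cos_pos_of_mem_Ioo ⟨by linarith [Real.pi_pos, not_le.1 h2], ?_⟩)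
    have := hs.2
    rw [stadiumLen_eq] at this
    linarith

/-- **The real part of the path is strictly increasing** on `[0, π + (b−a)/δ]` (its derivative
`re γ' > 0` inside). [folklore] -/
theorem strictMonoOn_stadiumPath_re :
    StrictMonoOn (fun s ↦ (stadiumPath a b δ s).re) (Icc 0 (stadiumLen a b δ)) := by
  have hS₁ := pi_div_two_le_stadiumS₁ hab hδ
  have hd : ∀ s, HasDerivAt (fun s ↦ (stadiumPath a b δ s).re) ((stadiumPathDeriv a b δ s).re) s :=
    fun s ↦ Complex.reCLM.hasFDerivAt.comp_hasDerivAt s (hasDerivAt_stadiumPath hab hδ s)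
  refine strictMonoOn_of_deriv_pos (convex_Icc _ _)
    (fun s _ ↦ (hd s).continuousAt.continuousWithinAt) fun s hs ↦ ?_
  rw [interior_Icc] at hs
  rw [(hd s).deriv]
  by_cases h1 : s ≤ Real.pi / 2
  · rw [stadiumPathDeriv_re_of_le h1]
    exact mul_pos hδ (Real.sin_pos_of_pos_of_lt_pi hs.1 (by linarith [Real.pi_pos]))
  by_cases h2 : s ≤ stadiumS₁ a b δ
  · rw [stadiumPathDeriv, if_neg h1, if_pos h2, ofReal_re]; exact hδ
  · rw [stadiumPathDeriv_re_of_lt (not_le.1 h2) hS₁]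
    refine mul_pos hδ (Real.cos_pos_of_mem_Ioo ⟨by linarith [Real.pi_pos, not_le.1 h2], ?_⟩)
    have := hs.2
    rw [stadiumLen_eq] at this
    linarith

/-- The path is injective on `[0, π + (b−a)/δ]`. [folklore] -/
theorem injOn_stadiumPath : InjOn (stadiumPath a b δ) (Icc 0 (stadiumLen a b δ)) :=
  fun _ hs _ ht hst ↦ (strictMonoOn_stadiumPath_re hab hδ).injOn hs ht (congrArg Complex.re hst)

/-- **The path is the graph arc `stadiumArc` reparametrised**: `γ(s) = stadiumArc(φ(s))` with
`φ(s) = (re γ(s) − (a − δ))/(b − a + 2δ)`. [folklore] -/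
theorem stadiumPath_eq_stadiumArc {s : ℝ} (hs : s ∈ Icc 0 (stadiumLen a b δ)) :
    stadiumPath a b δ s =
      stadiumArc a b δ (((stadiumPath a b δ s).re - (a - δ)) / (b - a + 2 * δ)) := by
  have hS₁ := pi_div_two_le_stadiumS₁ hab hδ
  have hL : 0 < b - a + 2 * δ := by linarith
  set x := (stadiumPath a b δ s).re with hx
  have hX : stadiumX a b δ ((x - (a - δ)) / (b - a + 2 * δ)) = x := by
    rw [stadiumX, div_mul_cancel₀ _ hL.ne']; ring
  apply Complex.ext
  · rw [stadiumArc_re, hX]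
  · rw [stadiumArc_im, hX, infDist_ofReal_eq hab]
    -- compute `im γ(s)` and `|x − proj x|` per piece
    rw [hx, stadiumPath]
    split_ifs with h1 h2
    · -- left cap: `x = a − δ cos s ≤ a`, `im = δ sin s`
      rw [stadiumPiece₁_im, stadiumPiece₁_re]
      have hc0 : 0 ≤ Real.cos s := Real.cos_nonneg_of_mem_Icc ⟨by linarith [hs.1, Real.pi_pos], h1⟩
      have hs0 : 0 ≤ Real.sin s := Real.sin_nonneg_of_nonneg_of_le_pi hs.1 (by linarith [Real.pi_pos])
      have hxa : a - δ * Real.cos s ≤ a := by nlinarith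
      rw [min_eq_right (hxa.trans hab), max_eq_left hxa,
        show a - δ * Real.cos s - a = -(δ * Real.cos s) by ring, abs_neg,
        abs_of_nonneg (mul_nonneg hδ.le hc0),
        show δ ^ 2 - (δ * Real.cos s) ^ 2 = (δ * Real.sin s) ^ 2 by nlinarith [Real.sin_sq_add_cos_sq s],
        Real.sqrt_sq (mul_nonneg hδ.le hs0)]
    · -- top segment: `x ∈ [a, b]`, `im = δ`
      rw [stadiumPiece₂_im, stadiumPiece₂_re]
      have hlo : a ≤ a + δ * (s - Real.pi / 2) := by nlinarith [not_le.1 h1]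
      have hhi : a + δ * (s - Real.pi / 2) ≤ b := by
        have : δ * (s - Real.pi / 2) ≤ δ * ((b - a) / δ) :=
          mul_le_mul_of_nonneg_left (by rw [stadiumS₁] at h2; linarith) hδ.le
        rw [mul_div_cancel₀ _ hδ.ne'] at this
        linarith
      rw [min_eq_right hhi, max_eq_right hlo, sub_self, abs_zero]
      simp [Real.sqrt_sq hδ.le]
    · -- right cap: `x = b + δ sin u ≥ b`, `im = δ cos u`, `u ∈ (0, π/2]`
      rw [stadiumPiece₃_im, stadiumPiece₃_re]
      set u := s - stadiumS₁ a b δ with hu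
      have hu0 : 0 ≤ u := by rw [hu]; linarith [not_le.1 h2]
      have hu1 : u ≤ Real.pi / 2 := by
        have := hs.2; rw [stadiumLen_eq] at this; rw [hu]; linarith
      have hsn : 0 ≤ Real.sin u := Real.sin_nonneg_of_nonneg_of_le_pi hu0 (by linarith [Real.pi_pos])
      have hcs : 0 ≤ Real.cos u := Real.cos_nonneg_of_mem_Icc ⟨by linarith [Real.pi_pos], hu1⟩
      have hxb : b ≤ b + δ * Real.sin u := by nlinarith
      rw [min_eq_left hxb, max_eq_right hab, show b + δ * Real.sin u - b = δ * Real.sin u by ring,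
        abs_of_nonneg (mul_nonneg hδ.le hsn),
        show δ ^ 2 - (δ * Real.sin u) ^ 2 = (δ * Real.cos u) ^ 2 by nlinarith [Real.sin_sq_add_cos_sq u],
        Real.sqrt_sq (mul_nonneg hδ.le hcs)]

/-- **The path has the same trace as the graph arc**: `γ(0, L) = stadiumArc(0, 1)`. [folklore] -/
theorem image_stadiumPath_Ioo :
    stadiumPath a b δ '' Ioo 0 (stadiumLen a b δ) = stadiumArc a b δ '' Ioo 0 1 := by
  have hL : 0 < b - a + 2 * δ := by linarith
  set φ : ℝ → ℝ := fun s ↦ ((stadiumPath a b δ s).re - (a - δ)) / (b - a + 2 * δ) with hφ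
  have hφ0 : φ 0 = 0 := by simp [hφ, stadiumPath_zero]
  have hφ1 : φ (stadiumLen a b δ) = 1 := by
    simp only [hφ, stadiumPath_len hab hδ, ofReal_re]
    rw [div_eq_one_iff_eq hL.ne']; ring
  have hφm : StrictMonoOn φ (Icc 0 (stadiumLen a b δ)) := fun s hs t ht hst ↦
    div_lt_div_of_pos_right (by linarith [strictMonoOn_stadiumPath_re hab hδ hs ht hst]) hL
  have hφc : ContinuousOn φ (Icc 0 (stadiumLen a b δ)) := by
    have : Continuous fun s ↦ (stadiumPath a b δ s).re :=
      continuous_re.comp (continuous_iff_continuousAt.2 fun s ↦ (hasDerivAt_stadiumPath hab hδ s).continuousAt)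
    exact ((this.sub continuous_const).div_const _).continuousOn
  have hφI : φ '' Ioo 0 (stadiumLen a b δ) = Ioo 0 1 := by
    apply Subset.antisymm
    · rintro _ ⟨s, hs, rfl⟩
      rw [← hφ0, ← hφ1]
      exact ⟨hφm (left_mem_Icc.2 (stadiumLen_pos hab hδ).le) (Ioo_subset_Icc_self hs) hs.1,
        hφm (Ioo_subset_Icc_self hs) (right_mem_Icc.2 (stadiumLen_pos hab hδ).le) hs.2⟩
    · have := intermediate_value_Ioo (stadiumLen_pos hab hδ).le hφc
      rwa [hφ0, hφ1] at this
  apply Subset.antisymm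
  · rintro _ ⟨s, hs, rfl⟩
    refine ⟨φ s, hφI ▸ mem_image_of_mem φ hs, ?_⟩
    exact (stadiumPath_eq_stadiumArc hab hδ (Ioo_subset_Icc_self hs)).symm
  · rintro _ ⟨t, ht, rfl⟩
    rw [← hφI] at ht
    obtain ⟨s, hs, rfl⟩ := ht
    exact ⟨s, hs, stadiumPath_eq_stadiumArc hab hδ (Ioo_subset_Icc_self hs)⟩

/-! #### Rescaling to `[0, 1]` -/

omit hab hδ in
/-- **The regular `C¹` parametrisation of the stadium boundary on `[0, 1]`.** [folklore] -/
def smoothStadiumArc (a b δ t : ℝ) : ℂ := stadiumPath a b δ (stadiumLen a b δ * t)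

omit hab hδ in
/-- Its velocity. [folklore] -/
def smoothStadiumArcDeriv (a b δ t : ℝ) : ℂ :=
  (stadiumLen a b δ : ℂ) * stadiumPathDeriv a b δ (stadiumLen a b δ * t)

/-- The rescaled arc is differentiable with velocity `L γ'(Lt)`. [folklore] -/
theorem hasDerivAt_smoothStadiumArc (t : ℝ) :
    HasDerivAt (smoothStadiumArc a b δ) (smoothStadiumArcDeriv a b δ t) t := by
  have h1 : HasDerivAt (fun t : ℝ ↦ stadiumLen a b δ * t) (stadiumLen a b δ) t := by
    simpa using (hasDerivAt_id t).const_mul (stadiumLen a b δ)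
  have := (hasDerivAt_stadiumPath hab hδ (stadiumLen a b δ * t)).scomp t h1
  exact this.congr_deriv (by rw [smoothStadiumArcDeriv, Complex.real_smul])

/-- The velocity of the rescaled arc is continuous. [folklore] -/
theorem continuous_smoothStadiumArcDeriv : Continuous (smoothStadiumArcDeriv a b δ) :=
  continuous_const.mul ((continuous_stadiumPathDeriv hab hδ).comp (continuous_const.mul continuous_id))

/-- The velocity of the rescaled arc never vanishes. [folklore] -/
theorem smoothStadiumArcDeriv_ne_zero (t : ℝ) : smoothStadiumArcDeriv a b δ t ≠ 0 :=
  mul_ne_zero (ofReal_ne_zero.2 (stadiumLen_pos hab hδ).ne') (stadiumPathDeriv_ne_zero hδ _)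

omit hab hδ in
/-- The rescaled arc starts at `a − δ`. [folklore] -/
theorem smoothStadiumArc_zero : smoothStadiumArc a b δ 0 = ((a - δ : ℝ) : ℂ) := by
  rw [smoothStadiumArc, mul_zero, stadiumPath_zero]

/-- The rescaled arc ends at `b + δ`. [folklore] -/
theorem smoothStadiumArc_one : smoothStadiumArc a b δ 1 = ((b + δ : ℝ) : ℂ) := by
  rw [smoothStadiumArc, mul_one, stadiumPath_len hab hδ]

/-- The rescaling `t ↦ L t` maps `[0,1]` onto `[0, L]` and `(0,1)` onto `(0, L)`. [folklore] -/
theorem stadiumLen_mul_mem_Icc_iff {t : ℝ} : stadiumLen a b δ * t ∈ Icc 0 (stadiumLen a b δ) ↔ t ∈ Icc (0 : ℝ) 1 := by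
  have hL := stadiumLen_pos hab hδ
  constructor
  · rintro ⟨h0, h1⟩
    exact ⟨by nlinarith, by nlinarith⟩
  · rintro ⟨h0, h1⟩
    exact ⟨by nlinarith, by nlinarith⟩

/-- The rescaling maps `(0,1)` onto `(0, L)`. [folklore] -/
theorem stadiumLen_mul_mem_Ioo_iff {t : ℝ} : stadiumLen a b δ * t ∈ Ioo 0 (stadiumLen a b δ) ↔ t ∈ Ioo (0 : ℝ) 1 := by
  have hL := stadiumLen_pos hab hδ
  constructor
  · rintro ⟨h0, h1⟩
    exact ⟨by nlinarith, by nlinarith⟩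
  · rintro ⟨h0, h1⟩
    exact ⟨by nlinarith, by nlinarith⟩

/-- The rescaled arc is injective on `[0, 1]`. [folklore] -/
theorem injOn_smoothStadiumArc : InjOn (smoothStadiumArc a b δ) (Icc 0 1) := by
  intro s hs t ht hst
  have hL := stadiumLen_pos hab hδ
  have := injOn_stadiumPath hab hδ ((stadiumLen_mul_mem_Icc_iff hab hδ).2 hs) ((stadiumLen_mul_mem_Icc_iff hab hδ).2 ht) hst
  exact mul_left_cancel₀ hL.ne' this

/-- The rescaled arc lies in `ℍ` at interior times. [folklore] -/
theorem smoothStadiumArc_im_pos {t : ℝ} (ht : t ∈ Ioo (0 : ℝ) 1) : 0 < (smoothStadiumArc a b δ t).im :=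
  stadiumPath_im_pos hab hδ ((stadiumLen_mul_mem_Ioo_iff hab hδ).2 ht)

/-- **Same trace as the graph arc.** [folklore] -/
theorem image_smoothStadiumArc_Ioo : smoothStadiumArc a b δ '' Ioo 0 1 = stadiumArc a b δ '' Ioo 0 1 := by
  rw [← image_stadiumPath_Ioo hab hδ]
  have hL := stadiumLen_pos hab hδ
  apply Subset.antisymm
  · rintro _ ⟨t, ht, rfl⟩
    exact ⟨_, (stadiumLen_mul_mem_Ioo_iff hab hδ).2 ht, rfl⟩
  · rintro _ ⟨s, hs, rfl⟩
    refine ⟨s / stadiumLen a b δ, ?_, by rw [smoothStadiumArc, mul_div_cancel₀ _ hL.ne']⟩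
    rw [← stadiumLen_mul_mem_Ioo_iff hab hδ, mul_div_cancel₀ _ hL.ne']
    exact hs

/-- Points of the closed arc lie in the closed stadium arc: `γ t = stadiumArc (φ t)` with
`φ t ∈ [0, 1]`. [folklore] -/
theorem exists_smoothStadiumArc_eq {t : ℝ} (ht : t ∈ Icc (0 : ℝ) 1) :
    ∃ t' ∈ Icc (0 : ℝ) 1, smoothStadiumArc a b δ t = stadiumArc a b δ t' := by
  have hL : 0 < b - a + 2 * δ := by linarith
  have hs := (stadiumLen_mul_mem_Icc_iff hab hδ).2 ht
  refine ⟨_, ?_, stadiumPath_eq_stadiumArc hab hδ hs⟩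
  have hm := (strictMonoOn_stadiumPath_re hab hδ).monotoneOn
  have h0 := hm (left_mem_Icc.2 (stadiumLen_pos hab hδ).le) hs hs.1
  have h1 := hm hs (right_mem_Icc.2 (stadiumLen_pos hab hδ).le) hs.2
  simp only [stadiumPath_zero, stadiumPath_len hab hδ, ofReal_re] at h0 h1
  constructor
  · exact div_nonneg (by linarith) hL.le
  · rw [div_le_one hL]; linarith

end SmoothStadium

/-! ### The hulls `E_δ` are smooth hulls of `𝒬₊` -/

namespace IsSlitHull

variable {A : Set ℂ} {p q : ℝ} (h : IsSlitHull A p q)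
include h

/-- **`E⁻¹` is conformal on `E(Ω)`**: at `w = E(z)` it has the complex derivative `E'(z)⁻¹`
(inverse function theorem, `E' ≠ 0`). [folklore] -/
theorem hasDerivAt_invExt {w : ℂ} (hw : w ∈ h.ext '' slitDomain A p q) :
    HasDerivAt h.invExt (deriv h.ext (h.invExt w))⁻¹ w := by
  have hz := h.invExt_mem hw
  refine HasDerivAt.of_local_left_inverse (f := h.ext)
    (h.continuousOn_invExt.continuousAt (h.isOpen_image_ext.mem_nhds hw))
    ?_ (h.deriv_ext_ne_zero hz) ?_
  · exact (h.differentiableAt_ext hz).hasDerivAt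
  · filter_upwards [h.isOpen_image_ext.mem_nhds hw] with y hy
    exact h.ext_invExt hy

/-- `E'` is continuous on `Ω`. [folklore] -/
theorem continuousOn_deriv_ext : ContinuousOn (deriv h.ext) (slitDomain A p q) :=
  (h.differentiableOn_ext.analyticOnNhd h.isOpen_slitDomain).deriv.continuousOn

/-- **The regular `C¹` boundary arc of `E_δ`**: `E⁻¹ ∘ (arc-length parametrisation of ∂D_δ)`. [folklore] -/
def smoothHullArc (δ t : ℝ) : ℂ := h.invExt (smoothStadiumArc h.lower h.upper δ t)

/-- Its velocity `(E' ∘ γ)⁻¹ · (velocity of the stadium arc)`. [folklore] -/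
def smoothHullArcDeriv (δ t : ℝ) : ℂ :=
  (deriv h.ext (h.smoothHullArc δ t))⁻¹ * smoothStadiumArcDeriv h.lower h.upper δ t

/-- The smooth stadium arc lies in `E(Ω)` (it has the same points as `stadiumArc`). [folklore] -/
theorem smoothStadiumArc_mem_image_ext {δ : ℝ} (hδ : 0 < δ) {t : ℝ} (ht : t ∈ Icc (0 : ℝ) 1) :
    smoothStadiumArc h.lower h.upper δ t ∈ h.ext '' slitDomain A p q := by
  obtain ⟨t', ht', heq⟩ := exists_smoothStadiumArc_eq h.lower_le_upper hδ ht
  rw [heq]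
  exact h.stadiumArc_mem_image_ext hδ ht'

/-- The boundary arc of `E_δ` is differentiable on `[0, 1]` (chain rule through `E⁻¹`). [folklore] -/
theorem hasDerivAt_smoothHullArc {δ : ℝ} (hδ : 0 < δ) {t : ℝ} (ht : t ∈ Icc (0 : ℝ) 1) :
    HasDerivAt (h.smoothHullArc δ) (h.smoothHullArcDeriv δ t) t :=
  (h.hasDerivAt_invExt (h.smoothStadiumArc_mem_image_ext hδ ht)).comp t
    (hasDerivAt_smoothStadiumArc h.lower_le_upper hδ t)

/-- The boundary arc of `E_δ` lies in `Ω`. [folklore] -/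
theorem smoothHullArc_mem_slitDomain {δ : ℝ} (hδ : 0 < δ) {t : ℝ} (ht : t ∈ Icc (0 : ℝ) 1) :
    h.smoothHullArc δ t ∈ slitDomain A p q :=
  h.invExt_mem (h.smoothStadiumArc_mem_image_ext hδ ht)

/-- The velocity of the boundary arc of `E_δ` is continuous on `[0, 1]`. [folklore] -/
theorem continuousOn_smoothHullArcDeriv {δ : ℝ} (hδ : 0 < δ) :
    ContinuousOn (h.smoothHullArcDeriv δ) (Icc 0 1) := by
  have hc : ContinuousOn (h.smoothHullArc δ) (Icc 0 1) := fun _ ht ↦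
    (h.hasDerivAt_smoothHullArc hδ ht).continuousAt.continuousWithinAt
  refine ContinuousOn.mul (ContinuousOn.inv₀ ?_ fun _ ht ↦ h.deriv_ext_ne_zero (h.smoothHullArc_mem_slitDomain hδ ht))
    (continuous_smoothStadiumArcDeriv h.lower_le_upper hδ).continuousOn
  exact h.continuousOn_deriv_ext.comp hc fun _ ht ↦ h.smoothHullArc_mem_slitDomain hδ ht

/-- The velocity of the boundary arc of `E_δ` never vanishes. [folklore] -/
theorem smoothHullArcDeriv_ne_zero {δ : ℝ} (hδ : 0 < δ) {t : ℝ} (ht : t ∈ Icc (0 : ℝ) 1) :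
    h.smoothHullArcDeriv δ t ≠ 0 :=
  mul_ne_zero (inv_ne_zero (h.deriv_ext_ne_zero (h.smoothHullArc_mem_slitDomain hδ ht)))
    (smoothStadiumArcDeriv_ne_zero h.lower_le_upper hδ t)

/-- The boundary arc of `E_δ` is injective on `[0, 1]`. [folklore] -/
theorem injOn_smoothHullArc {δ : ℝ} (hδ : 0 < δ) : InjOn (h.smoothHullArc δ) (Icc 0 1) :=
  fun _ ht _ ht' heq ↦ injOn_smoothStadiumArc h.lower_le_upper hδ ht ht'
    (h.injOn_invExt (h.smoothStadiumArc_mem_image_ext hδ ht) (h.smoothStadiumArc_mem_image_ext hδ ht') heq)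

/-- The boundary arc of `E_δ` starts on the real axis. [folklore] -/
theorem smoothHullArc_zero_im {δ : ℝ} (hδ : 0 < δ) : (h.smoothHullArc δ 0).im = 0 := by
  rw [smoothHullArc, smoothStadiumArc_zero]
  exact h.invExt_ofReal_im (h.ofReal_mem_image_ext_of_lt_lower (by linarith))

/-- The boundary arc of `E_δ` ends on the real axis. [folklore] -/
theorem smoothHullArc_one_im {δ : ℝ} (hδ : 0 < δ) : (h.smoothHullArc δ 1).im = 0 := by
  rw [smoothHullArc, smoothStadiumArc_one h.lower_le_upper hδ]
  exact h.invExt_ofReal_im (h.ofReal_mem_image_ext_of_upper_lt (by linarith))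

/-- Interior points of the boundary arc of `E_δ` lie in `ℍ ∖ A`. [folklore] -/
theorem smoothHullArc_mem_of_mem_Ioo {δ : ℝ} (hδ : 0 < δ) {t : ℝ} (ht : t ∈ Ioo (0 : ℝ) 1) :
    h.smoothHullArc δ t ∈ upperHalfPlaneSet \ A := by
  have hw := smoothStadiumArc_im_pos h.lower_le_upper hδ ht
  rw [smoothHullArc, h.invExt_eq_symm hw]
  exact h.symm_mem hw

/-- **The frontier of `E_δ` in `ℍ` is the open smooth arc.** [folklore] -/
theorem upperHalfPlaneSet_inter_frontier_arcHull {δ : ℝ} (hδ : 0 < δ) :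
    upperHalfPlaneSet ∩ frontier (h.arcHull δ) = h.smoothHullArc δ '' Ioo 0 1 := by
  have himg := image_smoothStadiumArc_Ioo h.lower_le_upper hδ
  ext z
  constructor
  · rintro ⟨hzH, hzfr⟩
    obtain ⟨hzA, hEfr⟩ := (h.mem_frontier_arcHull_iff hδ hzH).1 hzfr
    have hw : h.ext z ∈ upperHalfPlaneSet ∩ frontier (stadium h.lower h.upper δ) :=
      ⟨h.mapsTo_ext ⟨hzH, hzA⟩, hEfr⟩
    rw [upperHalfPlaneSet_inter_frontier_stadium h.lower_le_upper hδ, ← himg] at hw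
    obtain ⟨t, ht, hteq⟩ := hw
    refine ⟨t, ht, ?_⟩
    rw [smoothHullArc, hteq, h.invExt_ext (h.diff_subset_slitDomain ⟨hzH, hzA⟩)]
  · rintro ⟨t, ht, rfl⟩
    have hU := h.smoothHullArc_mem_of_mem_Ioo hδ ht
    refine ⟨hU.1, (h.mem_frontier_arcHull_iff hδ hU.1).2 ⟨hU.2, ?_⟩⟩
    have hw := smoothStadiumArc_im_pos h.lower_le_upper hδ ht
    have : h.ext (h.smoothHullArc δ t) = smoothStadiumArc h.lower h.upper δ t := by
      rw [smoothHullArc]; exact h.ext_invExt (h.upperHalfPlaneSet_subset_image_ext hw)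
    rw [this]
    have hmem : smoothStadiumArc h.lower h.upper δ t ∈
        upperHalfPlaneSet ∩ frontier (stadium h.lower h.upper δ) := by
      rw [upperHalfPlaneSet_inter_frontier_stadium h.lower_le_upper hδ, ← himg]; exact ⟨t, ht, rfl⟩
    exact hmem.2

/-- **`E_δ` is a smooth hull** (`IsSmoothHull`: bounded in `ℍ` by the regular `C¹` Jordan arc
`E⁻¹ ∘ ∂D_δ` with real endpoints). [cite: LawlerSchrammWerner2003Restriction, proof of Lemma 3.5 (p. 13, ∂E_δ ∩ ℍ̄ is a simple path) with Lemma 2.1 (smooth hulls)] -/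
theorem isSmoothHull_arcHull {δ : ℝ} (hδ : 0 < δ) (hδl : 2 * δ < h.lower) : IsSmoothHull (h.arcHull δ) :=
  ⟨(h.isStarHull_arcHull hδ hδl).isBoundedHull, h.smoothHullArc δ, h.smoothHullArcDeriv δ,
    fun _ ht ↦ (h.hasDerivAt_smoothHullArc hδ ht).hasDerivWithinAt, h.continuousOn_smoothHullArcDeriv hδ,
    fun _ ht ↦ h.smoothHullArcDeriv_ne_zero hδ ht, h.injOn_smoothHullArc hδ, h.smoothHullArc_zero_im hδ,
    h.smoothHullArc_one_im hδ, fun _ ht ↦ (h.smoothHullArc_mem_of_mem_Ioo hδ ht).1,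
    h.upperHalfPlaneSet_inter_frontier_arcHull hδ⟩

/-! #### `E_δ ∈ 𝒬₊` for hulls over the positive axis -/

/-- For a hull over the positive axis (`0 < min p q`), `E` is negative at negative points:
`E(0) = 0`, `E → −∞` at `−∞`, `E` is continuous and injective on the left free ray. [folklore] -/
theorem extRe_nonpos_of_nonpos (h0 : 0 < min p q) {x : ℝ} (hx : x ≤ 0) : h.extRe x ≤ 0 := by
  rcases hx.lt_or_eq with hx | rfl
  · by_contra hpos
    push Not at hpos
    -- a point `x' < x` with `E(x') < 0`
    obtain ⟨x', hx'neg, hx'x⟩ : ∃ x', h.extRe x' < 0 ∧ x' < x :=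
      ((h.tendsto_extRe_atBot.eventually (eventually_lt_atBot 0)).and (eventually_lt_atBot x)).exists
    -- `E` vanishes somewhere in `[x', x]`, contradicting injectivity (`E(0) = 0`, `x < 0`)
    have hcont : ContinuousOn h.extRe (Icc x' x) := fun y hy ↦
      (h.continuousAt_extRe (h.ofReal_mem_slitDomain_of_lt (by linarith [hy.2]))).continuousWithinAt
    obtain ⟨c, hc, hc0⟩ := intermediate_value_Icc hx'x.le hcont ⟨hx'neg.le, hpos.le⟩
    have hcΩ : (c : ℂ) ∈ slitDomain A p q := h.ofReal_mem_slitDomain_of_lt (by linarith [hc.2])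
    have hEc : h.ext c = h.ext 0 := by
      rw [h.ext_ofReal_eq hcΩ, hc0, h.ext_zero, ofReal_zero]
    have := h.injOn_ext hcΩ h.zero_mem_slitDomain hEc
    have hc00 : c = 0 := by exact_mod_cast this
    linarith [hc.2]
  · rw [extRe, ofReal_zero, h.ext_zero, zero_re]

/-- **`E_δ ∈ 𝒬₊`** when `A` lies over the positive axis: a real point `x ≤ 0` of
`E_δ = cl((A ∩ ℍ) ∪ Φ_A⁻¹(D_δ))` would be a limit of points of `ℍ ∖ A` mapped into `D_δ`,
but `E` is continuous at `x` with `E(x) ≤ 0 < ℓ₋ − δ`, off `D_δ`. [folklore] -/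
theorem isPlusHull_arcHull (h0 : 0 < min p q) {δ : ℝ} (hδ : 0 < δ) (hδl : 2 * δ < h.lower) :
    IsPlusHull (h.arcHull δ) := by
  refine ⟨h.isStarHull_arcHull hδ hδl, fun x hx ↦ ?_⟩
  by_contra hx0
  push Not at hx0
  have hxΩ : (x : ℂ) ∈ slitDomain A p q := h.ofReal_mem_slitDomain_of_lt (lt_of_le_of_lt hx0 h0)
  have hxA : (x : ℂ) ∉ A := fun hxA ↦ by
    have := (h.mem_uIcc x hxA).1
    rw [Set.mem_uIcc] at this
    rcases this with ⟨h1, -⟩ | ⟨h1, -⟩ <;> linarith [min_le_left p q, min_le_right p q]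
  -- `E x` is real, `≤ 0`, hence off the closed stadium
  have hEx : h.ext x ∉ stadium h.lower h.upper δ := fun hmem ↦ by
    rw [h.ext_ofReal_eq hxΩ] at hmem
    have h1 := (mem_Icc_of_ofReal_mem_stadium h.lower_le_upper hmem).1
    linarith [h.extRe_nonpos_of_nonpos h0 hx0]
  -- neighbourhoods of `x` off `A` and mapped off `D_δ`
  have hcont : ContinuousAt h.ext x := (h.differentiableAt_ext hxΩ).continuousAt
  have hev₁ : ∀ᶠ z in 𝓝 (x : ℂ), z ∉ A := h.isClosed_A.isOpen_compl.mem_nhds hxA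
  have hev₂ : ∀ᶠ z in 𝓝 (x : ℂ), h.ext z ∉ stadium h.lower h.upper δ :=
    hcont.preimage_mem_nhds (isClosed_stadium.isOpen_compl.mem_nhds hEx)
  have hev := hev₁.and hev₂
  obtain ⟨ε, hε, hball⟩ := Metric.mem_nhds_iff.1 hev
  -- but `x` is in the closure of the core of `E_δ`
  have hxcl : (x : ℂ) ∈ closure (hullProductCore (stadium h.lower h.upper δ) A h.restrictionMap) := hx
  obtain ⟨w, hw, hwx⟩ := Metric.mem_closure_iff.1 hxcl ε hε
  have hwball := hball (mem_ball_comm.1 hwx)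
  rcases hw with hwA | ⟨hwU, hwD⟩
  · exact hwball.1 hwA.1
  · rw [IsSlitHull.restrictionMap_apply] at hwD
    exact hwball.2 hwD

/-! ### Convergence of the derivatives `Φ'_{E_δₙ}(0) → Φ'_A(0)` -/

omit h in
/-- Below the real axis the reflected extension is the reflection: `G(z) = conj Φ(z̄)`. [folklore] -/
theorem reflectExt_of_im_neg {B : Set ℂ} {Φ : ConformalEquiv (upperHalfPlaneSet \ B) upperHalfPlaneSet}
    {r : ℝ} (hB : IsStarHull B) (hΦ : IsRestrictionMap B Φ) (hr : Disjoint (ball (0 : ℂ) (2 * r)) B)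
    {z : ℂ} (hz : z.im < 0) (hzr : z ∈ ball (0 : ℂ) r) :
    reflectExt hB hΦ hr z = conj (Φ (conj z)) := by
  have hG := Classical.choose_spec (hΦ.exists_extension hB hr)
  have hcz : conj z ∈ upperHalfPlaneSet ∩ ball (0 : ℂ) r :=
    ⟨show 0 < (conj z).im by rw [conj_im]; linarith, by simpa [mem_ball_zero_iff] using hzr⟩
  simp only [reflectExt, if_neg (not_le.2 hz)]
  rw [hG.2 hcz]

omit h in
/-- **Uniform convergence on the upper half-disc gives uniform convergence of the reflected
extensions on the disc** (reflection below the axis, continuity on the axis). [folklore] -/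
theorem tendstoUniformlyOn_reflectExt {B : Set ℂ} {Bn : ℕ → Set ℂ}
    {Φ : ConformalEquiv (upperHalfPlaneSet \ B) upperHalfPlaneSet}
    {Ψ : ∀ n, ConformalEquiv (upperHalfPlaneSet \ Bn n) upperHalfPlaneSet} {r : ℝ}
    (hB : IsStarHull B) (hBn : ∀ n, IsStarHull (Bn n)) (hΦ : IsRestrictionMap B Φ)
    (hΨ : ∀ n, IsRestrictionMap (Bn n) (Ψ n)) (hr : Disjoint (ball (0 : ℂ) (2 * r)) B)
    (hrn : ∀ n, Disjoint (ball (0 : ℂ) (2 * r)) (Bn n))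
    (hconv : TendstoUniformlyOn (fun n z ↦ Ψ n z) (fun z ↦ Φ z) atTop (upperHalfPlaneSet ∩ ball (0 : ℂ) r)) :
    TendstoUniformlyOn (fun n ↦ reflectExt (hBn n) (hΨ n) (hrn n)) (reflectExt hB hΦ hr) atTop
      (ball (0 : ℂ) r) := by
  set G := reflectExt hB hΦ hr
  set Gn := fun n ↦ reflectExt (hBn n) (hΨ n) (hrn n)
  rw [Metric.tendstoUniformlyOn_iff] at hconv ⊢
  intro ε hε
  filter_upwards [hconv (ε / 2) (by linarith)] with n hn z hz
  have hGc : ContinuousOn G (ball 0 r) := (differentiableOn_reflectExt hB hΦ hr).continuousOn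
  have hGnc : ContinuousOn (Gn n) (ball 0 r) := (differentiableOn_reflectExt (hBn n) (hΨ n) (hrn n)).continuousOn
  rcases lt_trichotomy z.im 0 with him | him | him
  · -- below the axis: reflect
    have hcz : conj z ∈ upperHalfPlaneSet ∩ ball (0 : ℂ) r :=
      ⟨show 0 < (conj z).im by rw [conj_im]; linarith, by simpa [mem_ball_zero_iff] using hz⟩
    have h1 := hn (conj z) hcz
    show dist (G z) (Gn n z) < ε
    rw [show G z = conj (Φ (conj z)) from reflectExt_of_im_neg hB hΦ hr him hz,
      show Gn n z = conj (Ψ n (conj z)) from reflectExt_of_im_neg (hBn n) (hΨ n) (hrn n) him hz,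
      Complex.dist_conj_conj]
    linarith
  · -- on the axis: limit from above
    have hzcl : z ∈ closure (upperHalfPlaneSet ∩ ball (0 : ℂ) r) := by
      have hzre : z = (z.re : ℂ) := Complex.ext (by simp) (by simp [him])
      rw [hzre]
      refine ofReal_mem_closure_inter_ball ?_
      have : ‖z‖ < r := mem_ball_zero_iff.1 hz
      calc |z.re| ≤ ‖z‖ := abs_re_le_norm z
        _ < r := this
    haveI : (𝓝[upperHalfPlaneSet ∩ ball (0 : ℂ) r] z).NeBot := mem_closure_iff_nhdsWithin_neBot.1 hzcl
    have hT : Tendsto (fun w ↦ dist (G w) (Gn n w)) (𝓝[upperHalfPlaneSet ∩ ball (0 : ℂ) r] z)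
        (𝓝 (dist (G z) (Gn n z))) := by
      have h1 : ContinuousAt G z := hGc.continuousAt (isOpen_ball.mem_nhds hz)
      have h2 : ContinuousAt (Gn n) z := hGnc.continuousAt (isOpen_ball.mem_nhds hz)
      exact (Filter.Tendsto.dist h1 h2).mono_left nhdsWithin_le_nhds
    have hle : dist (G z) (Gn n z) ≤ ε / 2 := by
      refine le_of_tendsto hT (eventually_nhdsWithin_of_forall fun w hw ↦ ?_)
      have := hn w hw
      rw [show G w = Φ w from reflectExt_eq hB hΦ hr hw,
        show Gn n w = Ψ n w from reflectExt_eq (hBn n) (hΨ n) (hrn n) hw]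
      exact this.le
    show dist (G z) (Gn n z) < ε
    linarith
  · -- above the axis
    have hw : z ∈ upperHalfPlaneSet ∩ ball (0 : ℂ) r := ⟨him, hz⟩
    show dist (G z) (Gn n z) < ε
    rw [show G z = Φ z from reflectExt_eq hB hΦ hr hw,
      show Gn n z = Ψ n z from reflectExt_eq (hBn n) (hΨ n) (hrn n) hw]
    linarith [hn z hw]

omit h in
/-- **Convergence of `Φ'(0)` from uniform convergence of the maps near `0`** ([LSW] p. 12: "It
is immediate that `Φ'_{A_n}(0) → Φ'_A(0)`, by Cauchy's derivative formula (the maps may be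
extended to a neighborhood of `0` by Schwarz reflection in the real line)"): the reflected
extensions converge uniformly on a disc around `0`, hence so do their derivatives
(`TendstoLocallyUniformlyOn.deriv`), and `G'(0) = Φ'(0)` (`deriv_reflectExt_zero`).
[cite: LawlerSchrammWerner2003Restriction, proof of Lemma 3.5 (p. 12, Cauchy's derivative formula after Schwarz reflection)] -/
theorem tendsto_restrictionDeriv_of_tendstoUniformlyOn {B : Set ℂ} {Bn : ℕ → Set ℂ}
    {Φ : ConformalEquiv (upperHalfPlaneSet \ B) upperHalfPlaneSet}
    {Ψ : ∀ n, ConformalEquiv (upperHalfPlaneSet \ Bn n) upperHalfPlaneSet} {r : ℝ} (hr0 : 0 < r)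
    (hB : IsStarHull B) (hBn : ∀ n, IsStarHull (Bn n)) (hΦ : IsRestrictionMap B Φ)
    (hΨ : ∀ n, IsRestrictionMap (Bn n) (Ψ n)) (hr : Disjoint (ball (0 : ℂ) (2 * r)) B)
    (hrn : ∀ n, Disjoint (ball (0 : ℂ) (2 * r)) (Bn n))
    (hconv : TendstoUniformlyOn (fun n z ↦ Ψ n z) (fun z ↦ Φ z) atTop (upperHalfPlaneSet ∩ ball (0 : ℂ) r))
    {d : ℝ} {dn : ℕ → ℝ} (hd : HasRestrictionDeriv B Φ d) (hdn : ∀ n, HasRestrictionDeriv (Bn n) (Ψ n) (dn n)) :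
    Tendsto dn atTop (𝓝 d) := by
  have hU := tendstoUniformlyOn_reflectExt hB hBn hΦ hΨ hr hrn hconv
  have hD := hU.tendstoLocallyUniformlyOn.deriv
    (Eventually.of_forall fun n ↦ differentiableOn_reflectExt (hBn n) (hΨ n) (hrn n)) isOpen_ball
  have h0 := hD.tendsto_at (mem_ball_self hr0)
  simp only [Function.comp_apply, deriv_reflectExt_zero hB hΦ hr hr0 hd] at h0
  have h1 : Tendsto (fun n ↦ ((dn n : ℂ)).re) atTop (𝓝 ((d : ℂ)).re) := by
    refine ((continuous_re.tendsto _).comp h0).congr fun n ↦ ?_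
    simp only [Function.comp_apply, deriv_reflectExt_zero (hBn n) (hΨ n) (hrn n) hr0 (hdn n)]
  simpa using h1

/-- **`Φ'_{E_δₙ}(0) → Φ'_A(0)`** for the hulls `E_δₙ` of a hull over the positive axis: the maps
converge uniformly on a small upper half-disc around `0` (`tendstoUniformlyOn_arcHull`; the
half-disc misses `A ∪ [p, q]`), so the derivatives at `0` converge
(`tendsto_restrictionDeriv_of_tendstoUniformlyOn`). [cite: LawlerSchrammWerner2003Restriction, Lemma 2.1 (p. 8) and proof of Lemma 3.5 (p. 12)] -/
theorem tendsto_restrictionDeriv_arcHull (h0 : 0 < min p q)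
    {Φ' : ConformalEquiv (upperHalfPlaneSet \ A) upperHalfPlaneSet}
    {Ψ : ∀ n, ConformalEquiv (upperHalfPlaneSet \ h.arcHull (h.deltaSeq n)) upperHalfPlaneSet}
    (hΦ' : IsRestrictionMap A Φ') (hΨ : ∀ n, IsRestrictionMap (h.arcHull (h.deltaSeq n)) (Ψ n))
    {d : ℝ} {dn : ℕ → ℝ} (hd : HasRestrictionDeriv A Φ' d)
    (hdn : ∀ n, HasRestrictionDeriv (h.arcHull (h.deltaSeq n)) (Ψ n) (dn n)) :
    Tendsto dn atTop (𝓝 d) := by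
  have hJst : ∀ n, IsStarHull (h.arcHull (h.deltaSeq n)) := fun n ↦
    h.isStarHull_arcHull (h.deltaSeq_pos h0 n) (h.two_mul_deltaSeq_lt h0 n)
  have hanti : Antitone fun n ↦ h.arcHull (h.deltaSeq n) := by
    rcases h.deltaSeq_antitone with hm | hle
    · exact fun m n hmn ↦ h.arcHull_mono (hm hmn)
    · exact absurd (h.lower_pos h0) (not_lt.2 hle)
  -- a radius `r` with `B(0, 2r)` off `J 0 ⊇ J n ⊇ A` and `r < min p q`
  obtain ⟨r₀, hr₀, hdisj₀⟩ := (hJst 0).exists_disjoint_ball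
  set r := min r₀ (min p q / 2) with hr
  have hr0 : 0 < r := lt_min hr₀ (by linarith)
  have hrr₀ : r ≤ r₀ := min_le_left _ _
  have hrn : ∀ n, Disjoint (ball (0 : ℂ) (2 * r)) (h.arcHull (h.deltaSeq n)) := fun n ↦
    (hdisj₀.mono_left (ball_subset_ball (by linarith))).mono_right (hanti (Nat.zero_le n))
  have hrA : Disjoint (ball (0 : ℂ) (2 * r)) A := (hrn 0).mono_right h.subset_arcHull
  -- uniform convergence on the upper half-disc
  have hS : upperHalfPlaneSet ∩ ball (0 : ℂ) r ⊆ upperHalfPlaneSet := inter_subset_left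
  have hcl : closure (upperHalfPlaneSet ∩ ball (0 : ℂ) r) ⊆ closedBall 0 r :=
    (closure_mono inter_subset_right).trans (by rw [closure_ball 0 hr0.ne'])
  have hcpt : IsCompact (closure (upperHalfPlaneSet ∩ ball (0 : ℂ) r)) :=
    (isCompact_closedBall 0 r).of_isClosed_subset isClosed_closure hcl
  have hdisjF : Disjoint (closure (upperHalfPlaneSet ∩ ball (0 : ℂ) r)) (IsSlitHull.filling A p q) := by
    refine Set.disjoint_left.2 fun z hz hzF ↦ ?_
    have hzr : ‖z‖ ≤ r := mem_closedBall_zero_iff.1 (hcl hz)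
    rcases hzF with hzA | hzS
    · exact hrA.le_bot ⟨mem_ball_zero_iff.2 (by linarith), hzA⟩
    · obtain ⟨x, hx, rfl⟩ := hzS
      rw [norm_real, Real.norm_eq_abs] at hzr
      rw [Set.mem_uIcc] at hx
      have : min p q ≤ |x| := by
        rcases hx with ⟨h1, -⟩ | ⟨h1, -⟩
        · exact (min_le_left p q).trans (h1.trans (le_abs_self x))
        · exact (min_le_right p q).trans (h1.trans (le_abs_self x))
      linarith [min_le_right r₀ (min p q / 2)]
  have hconv := h.tendstoUniformlyOn_arcHull h0 hΦ' hΨ hS hcpt hdisjF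
  exact tendsto_restrictionDeriv_of_tendstoUniformlyOn hr0 h.isStarHull hJst hΦ' hΨ hrA hrn hconv hd hdn

end IsSlitHull

/-! ### The named fact `IsPlusHull.exists_antitone_isSmoothHull`, discharged -/

/-- **[LSW] Lemma 2.1 for SMOOTH hulls, PROVED** (`Literature.Probability.RandomPlanarGeometry.IsPlusHull.exists_antitone_isSmoothHull`
holds): for nonempty `A ∈ 𝒬₊` the hulls `E_{δₙ} = D_{δₙ} · A` of [LSW]'s proof of Lemma 3.5
(`ArcApproximation`) are smooth hulls of `𝒬₊` decreasing to `A ∪ [p, q]` (`p = x₀/2`,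
`q = x₁`), and `Φ'_{E_δₙ}(0) ↑ Φ'_A(0)` (monotone by `HasRestrictionDeriv.le_of_subset`,
convergent by `tendsto_restrictionDeriv_arcHull`).
[cite: LawlerSchrammWerner2003Restriction, Lemma 2.1 (p. 8) with the proof of Lemma 3.5 (p. 13, the hulls E_δ)] -/
theorem IsPlusHull.exists_antitone_isSmoothHull_holds : IsPlusHull.exists_antitone_isSmoothHull := by
  intro A hA hne
  have h := hA.isSlitHull hne
  have h0 : 0 < min (sInf (realTrace A) / 2) (sSup (realTrace A)) := by
    have hT : IsCompact (realTrace A) := isCompact_realTrace hA.1.isBoundedHull.isCompact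
    have hTne : (realTrace A).Nonempty := hA.1.isBoundedHull.realTrace_nonempty hne
    have hm : sInf (realTrace A) ∈ realTrace A := hT.sInf_mem hTne
    have hm0 : 0 < sInf (realTrace A) := hA.2 _ hm
    have hmM : sInf (realTrace A) ≤ sSup (realTrace A) := le_csSup hT.bddAbove hm
    exact lt_min (by linarith) (by linarith)
  have hanti : Antitone fun n ↦ h.arcHull (h.deltaSeq n) := by
    rcases h.deltaSeq_antitone with hm | hle
    · exact fun m n hmn ↦ h.arcHull_mono (hm hmn)
    · exact absurd (h.lower_pos h0) (not_lt.2 hle)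
  have hJst : ∀ n, IsStarHull (h.arcHull (h.deltaSeq n)) := fun n ↦
    h.isStarHull_arcHull (h.deltaSeq_pos h0 n) (h.two_mul_deltaSeq_lt h0 n)
  refine ⟨fun n ↦ h.arcHull (h.deltaSeq n), IsSlitHull.filling A _ _,
    fun n ↦ h.isSmoothHull_arcHull (h.deltaSeq_pos h0 n) (h.two_mul_deltaSeq_lt h0 n),
    fun n ↦ h.isPlusHull_arcHull h0 (h.deltaSeq_pos h0 n) (h.two_mul_deltaSeq_lt h0 n),
    hanti, h.iInter_arcHull h0, IsSlitHull.subset_filling, IsSlitHull.filling_inter_subset,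
    h.zero_notMem_filling,
    fun hΦ hd hΨ hdn ↦ ⟨?_, h.tendsto_restrictionDeriv_arcHull h0 hΦ hΨ hd hdn⟩⟩
  exact monotone_nat_of_le_succ fun n ↦
    HasRestrictionDeriv.le_of_subset (hJst n) (hJst (n + 1)) (hanti (Nat.le_succ n)) (hΨ n) (hΨ (n + 1))
      (hdn n) (hdn (n + 1))


end Literature.Probability.RandomPlanarGeometry

end
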